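import Literature.MathematicalPhysics.QuantumFieldTheory.Balaban1983to89.B9Thm31SiteGradGpDivDecayReg335Y
import Literature.MathematicalPhysics.QuantumFieldTheory.Balaban1983to89.B9Thm31SiteGpGradDecayPar

/-!
# `Balaban1983to89.B9Thm31SiteGradGpDivDecayPar` — T. Bałaban, *Propagators for lattice gauge theories in a background field*, Commun. Math. Phys. **99** (1985)
# 389–434 [Balaban1985BackgroundPropagators] Thm 3.1 (3.46)∕(3.47) p. 398 (the entry `∇_U G′(U) ∇\*_U`) with (3.8) p. 392, by S. Agmon's method [Agmon1982]: ★★ **THE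
# ORDER-ZERO OPERATOR `∇_U G′(U; par) ∇\*_U` AT A GENERIC SITE TRANSPORTER FROM THE THREE TRANSPORTER LAWS** — dag-n06-w1's `B9Thm31SiteGradGpDivDecayReg335Y` re-pressed
# over `par` (link 4 of the CASCADE-K re-press of the (3.46)₄ chain; links 1–3 = `B9Thm31SiteGpDecayPar`, `B9Thm31SiteAgmonWeightPar`, `B9Thm31SiteGpGradDecayPar`)

statement-level skeleton of published theorems with citation tags; proofs where landed; nothing here is a claim about the Yang–Mills mass gap

WHY THIS FILE.  w1's file 14 proves, for `G′ = GpY i (parSymY i)`: §1 the global contraction `Σ_ν‖∇_{U,ν}G′∇\*_{U,μ}λ‖²₁ ≤ ‖λ‖²₁` at every `G`-valued background and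
§2 the `L²`-local decay `Σ_{z∈A}Σ_ν HS((∇_νG′∇\*_μλ)(z)) ≤ 10·‖λ‖²₁∕W²` on the class (3.35).  The transporter enters only through `parSymY_mem`, `parSymY_inv_symm`,
`isUnit_deltaPrimeAY_parSymY` and file 6's coercivity.  THIS FILE displays them: ★★★ `sum_trIP_cdS_GpY_cdsS_le_par` ∕ ★★ `trIP_cdS_GpY_cdsS_le_par` (§1 at any `par` with
`G`-valued inverse-symmetric legs and `Δ′_a(U; par)` a unit — no smallness), ★ `graddiv_arith_par` (§2's arithmetic at a coercivity constant `κ₀ > 0`; the constant `10` is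
`κ₀`-free), ★★★ `hs_restrict_cdS_GpY_cdsS_le_par` (§2 under the level-weighted coercivity `κ₀ ∈ (0, 1∕8]`, budget `(d+1)θ_b + θ_s∕2 ≤ κ₀∕2`) and ★★
`hs_restrict_cdS_GpY_cdsS_le_exp_par` (Agmon weight `e^{δρ}` at a parametric rate, `δ²(2(d+1) + (d+1)²) ≤ κ₀∕2`).  Proofs: w1's, verbatim up to the constants.
HONEST SCOPE.  One finite lattice operator at a time, laws displayed; NOT a node discharge; count-neutral; nothing continuum ∕ OS ∕ mass gap ∕ Clay.
Cell `pub-ymgap` (D-0062), Track A node N06 [B9], seat `pub-ymgap-dag-n06-l` (g37), 2026-08-30; NEW file; nothing landed is modified.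
-/

noncomputable section

namespace Literature.MathematicalPhysics.QuantumFieldTheory.Balaban1983to89.B9Thm31SiteGradGpDivDecayPar

open Literature.MathematicalPhysics.QuantumFieldTheory.Balaban1983to89
open Node00 B6KLevelCensusIndexV1 B6Geom246MultiLevelBox B6MultiLevelBoxOperator B6MultiLevelTorusOperator B6GlobalChartV1 B9BackgroundsKLevelV1
  B9Eq39Adjoint B9Thm311ReadingCoords B9Thm311DeltaPrimePos B9Ineq369CurvatureSmallAtLettersY B9Thm31SiteCoerciveGaugeBlockY
  B9Thm31SiteCoerciveReg335Y B9Thm31SiteGpBoundsReg335Y B9Thm31SitePolarisedFormY B9Thm31SiteConjugatedFormY B9Thm31SiteGpDecayReg335Y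
  B9Thm31SiteAgmonWeightY B9Thm31SiteGpGradDecayReg335Y B9Thm31SiteGradGpDivDecayReg335Y B9Thm31SiteGpDecayPar B9Thm31SiteAgmonWeightPar
  B9Thm31SiteGpGradDecayPar
open Literature.MathematicalPhysics.QuantumFieldTheory.Balaban1983to89.B9Ineq349SiteAdjoint (trIP_comm trIP_cdS_left)
open Literature.MathematicalPhysics.QuantumFieldTheory.Balaban1983to89.B9Thm311FlippedBondLetters (hs_real_smul)
open scoped Matrix Matrix.Norms.L2Operator

variable {d ℓ : ℕ} {hd : 1 ≤ d + 1} {hL : Odd (ℓ + 1) ∧ 1 < ℓ + 1} {b₀ b₁ : ℝ}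
variable (i : KIdx d ℓ hd hL b₀ b₁) {N : ℕ} {G : Subgroup (Matrix (Fin N) (Fin N) ℂ)ˣ} (par : SiteParY (Matrix (Fin N) (Fin N) ℂ) i)

/-! ## §1 The global bound at a generic transporter -/

/-- ★★★ **`Σ_ν ‖∇_{U,ν}G′(U; par)∇\*_{U,μ}λ‖²₁ ≤ ‖λ‖²₁` AT EVERY `G`-VALUED BACKGROUND**, `G ≤ U(N)`, for any site transporter with `G`-valued inverse-symmetric legs at `U`
and `Δ′_a(U; par)` a unit (no smallness). [cite: Balaban1985BackgroundPropagators, Thm 3.1 (3.47) p.398, (3.8) p.392, (3.24) p.394] -/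
theorem sum_trIP_cdS_GpY_cdsS_le_par (hG : G ≤ B7Prop2Explicit.unitaryUnits (Matrix (Fin N) (Fin N) ℂ)) {U : CfgY (Matrix (Fin N) (Fin N) ℂ) i}
    (hU : ∀ μ x, U μ x ∈ G) (hpar : ∀ z w : SiteY i, par U z w ∈ G) (hinv : ∀ z z' : SiteY i, par U z z' = (par U z' z)⁻¹)
    (hunit : IsUnit (deltaPrimeAY i par U)) (μ : Fin (d + 1)) (Λ : SiteY i → Matrix (Fin N) (Fin N) ℂ) :
    ∑ ν : Fin (d + 1), trIP (fun _ => (1 : ℝ)) (cdS i U ν (GpY i par U (cdsS i U μ Λ))) (cdS i U ν (GpY i par U (cdsS i U μ Λ)))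
      ≤ trIP (fun _ => (1 : ℝ)) Λ Λ := by
  set Φ := GpY i par U (cdsS i U μ Λ) with hΦ
  set E := ∑ ν : Fin (d + 1), trIP (fun _ => (1 : ℝ)) (cdS i U ν Φ) (cdS i U ν Φ) with hE
  have hΔΦ : deltaPrimeAY i par U Φ = cdsS i U μ Λ := apply_inverse_of_isUnit hunit _
  have hE0 : 0 ≤ E := Finset.sum_nonneg fun _ _ => trIP_self_nonneg _ (fun _ => one_pos) _
  have hQ0 : 0 ≤ trIP (fun _ => (1 : ℝ)) Λ Λ := trIP_self_nonneg _ (fun _ => one_pos) Λ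
  have h1 : E ≤ trIP (fun _ => (1 : ℝ)) (cdS i U μ Φ) Λ := by
    have h := sum_trIP_cdS_le_trIP_deltaPrimeAY i hG par U hinv hpar hU Φ
    rw [hΔΦ, ← trIP_cdS_left i (fun μ x => hG (hU μ x)) μ Φ Λ] at h
    exact h
  have h2 : trIP (fun _ => (1 : ℝ)) (cdS i U μ Φ) Λ ^ 2 ≤ E * trIP (fun _ => (1 : ℝ)) Λ Λ := by
    have hcs := trIP_sq_le (fun _ => (1 : ℝ)) (fun _ => one_pos) (cdS i U μ Φ) Λ
    have hμ : trIP (fun _ => (1 : ℝ)) (cdS i U μ Φ) (cdS i U μ Φ) ≤ E :=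
      Finset.single_le_sum (f := fun ν => trIP (fun _ => (1 : ℝ)) (cdS i U ν Φ) (cdS i U ν Φ)) (fun _ _ => trIP_self_nonneg _ (fun _ => one_pos) _)
        (Finset.mem_univ μ)
    exact hcs.trans (mul_le_mul_of_nonneg_right hμ hQ0)
  have h3 : E ^ 2 ≤ E * trIP (fun _ => (1 : ℝ)) Λ Λ := (pow_le_pow_left₀ hE0 h1 2).trans h2
  rcases hE0.eq_or_lt with h0 | hpos
  · rw [← h0]; exact hQ0
  · have h4 : E * E ≤ trIP (fun _ => (1 : ℝ)) Λ Λ * E := by nlinarith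
    exact le_of_mul_le_mul_right h4 hpos

/-- ★★ one direction: `‖∇_{U,ν}G′(U; par)∇\*_{U,μ}λ‖²₁ ≤ ‖λ‖²₁` at every `G`-valued background (legs `G`-valued inverse-symmetric, `Δ′_a(U; par)` a unit).
[cite: Balaban1985BackgroundPropagators, Thm 3.1 (3.47) p.398] -/
theorem trIP_cdS_GpY_cdsS_le_par (hG : G ≤ B7Prop2Explicit.unitaryUnits (Matrix (Fin N) (Fin N) ℂ)) {U : CfgY (Matrix (Fin N) (Fin N) ℂ) i}
    (hU : ∀ μ x, U μ x ∈ G) (hpar : ∀ z w : SiteY i, par U z w ∈ G) (hinv : ∀ z z' : SiteY i, par U z z' = (par U z' z)⁻¹)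
    (hunit : IsUnit (deltaPrimeAY i par U)) (ν μ : Fin (d + 1)) (Λ : SiteY i → Matrix (Fin N) (Fin N) ℂ) :
    trIP (fun _ => (1 : ℝ)) (cdS i U ν (GpY i par U (cdsS i U μ Λ))) (cdS i U ν (GpY i par U (cdsS i U μ Λ))) ≤ trIP (fun _ => (1 : ℝ)) Λ Λ :=
  le_trans (Finset.single_le_sum (f := fun ν => trIP (fun _ => (1 : ℝ)) (cdS i U ν (GpY i par U (cdsS i U μ Λ))) (cdS i U ν (GpY i par U (cdsS i U μ Λ))))
    (fun _ _ => trIP_self_nonneg _ (fun _ => one_pos) _) (Finset.mem_univ ν)) (sum_trIP_cdS_GpY_cdsS_le_par i par hG hU hpar hinv hunit μ Λ)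

/-! ## §2 The local decay from the coercivity law -/

/-- THE ARITHMETIC OF §2 AT A COERCIVITY CONSTANT `κ₀`: `E ≤ X + κM`, `S ≤ 2E + 6θM`, `W²P ≤ S`, `κ, θ ≤ κ₀∕2`, `(κ₀ − κ)M ≤ X`, `X ≤ Q`, `M ≥ 0`, `W > 0` ⇒
`P ≤ 10·Q∕W²` (the constant is `κ₀`-free). [cite: Agmon1982, Ch.1, bookkeeping] -/
theorem graddiv_arith_par {E X M S P Q W κ θ κ₀ : ℝ} (hE : E ≤ X + κ * M) (hS : S ≤ 2 * E + 6 * θ * M) (hP : W ^ 2 * P ≤ S)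
    (hκ : κ ≤ κ₀ / 2) (hθ : θ ≤ κ₀ / 2) (hiX : (κ₀ - κ) * M ≤ X) (hXQ : X ≤ Q) (hM0 : 0 ≤ M) (hW : 0 < W) : P ≤ 10 * Q / W ^ 2 := by
  have hc : κ₀ / 2 ≤ κ₀ - κ := by linarith
  have hMX : κ₀ * M ≤ 2 * X := by nlinarith
  have hκM : κ * M ≤ (κ₀ / 2) * M := mul_le_mul_of_nonneg_right hκ hM0
  have hθM : θ * M ≤ (κ₀ / 2) * M := mul_le_mul_of_nonneg_right hθ hM0
  have hS' : S ≤ 10 * X := by nlinarith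
  have h2 : W ^ 2 * P ≤ 10 * Q := by linarith
  have hW2 : 0 < W ^ 2 := by positivity
  rw [le_div_iff₀ hW2]
  linarith

/-- ★★★ **THE `L²`-LOCAL DECAY OF `∇_U G′(U; par) ∇\*_U` FROM THE THREE TRANSPORTER LAWS** — (3.46e)'s SHAPE, NO SCALE FACTOR.  `G ≤ U(N)`, `N ≥ 1`; `U` `G`-valued, legs
`par U z w ∈ G` inverse-symmetric, level-weighted coercivity `κ₀ ∈ (0, 1∕8]` of `Δ′_a(U; par)`; a weight `ω > 0` with `ω = 1` on `B ⊇ supp ∇\*_{U,μ}λ`, `ω ≥ W > 0` on `A`,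
bond ratios `q ≤ θ_b·(L^{lev})⁻²` (both ends), block oscillation `q ≤ θ_s`, `0 ≤ θ_b, θ_s`, `(d+1)θ_b + θ_s∕2 ≤ κ₀∕2`.  THEN
`Σ_{z∈A}Σ_ν HS((∇_{U,ν}G′(U; par)∇\*_{U,μ}λ)(z)) ≤ 10·‖λ‖²₁∕W²`. [cite: Balaban1985BackgroundPropagators, Thm 3.1 (3.46) p.398; Agmon1982, Ch.1, Thm 1.5] -/
theorem hs_restrict_cdS_GpY_cdsS_le_par [Nonempty (Fin N)] (hG : G ≤ B7Prop2Explicit.unitaryUnits (Matrix (Fin N) (Fin N) ℂ))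
    {U : CfgY (Matrix (Fin N) (Fin N) ℂ) i} (hU : ∀ μ x, U μ x ∈ G) (hpar : ∀ z w : SiteY i, par U z w ∈ G)
    (hinv : ∀ z z' : SiteY i, par U z z' = (par U z' z)⁻¹) {κ₀ : ℝ} (hκ₀ : 0 < κ₀) (hκ₀1 : κ₀ ≤ 1 / 8)
    (hcoer : ∀ Φ : SiteY i → Matrix (Fin N) (Fin N) ℂ,
      κ₀ * ∑ z : SiteY i, (((((ℓ + 1) ^ (blkOf i.D.toDomains z).1.1 : ℕ) : ℝ)) ^ 2)⁻¹ * ∑ a, ∑ b, ‖Φ z a b‖ ^ 2 ≤ trIP (fun _ => (1 : ℝ)) Φ (deltaPrimeAY i par U Φ))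
    {ω : SiteY i → ℝ} (hω : ∀ z, 0 < ω z) {θb θs : ℝ} (hθb0 : 0 ≤ θb) (hθs0 : 0 ≤ θs)
    (hb1 : ∀ μ z, ω (shiftY i μ z) / ω z + ω z / ω (shiftY i μ z) - 2 ≤ θb * (((((ℓ + 1) ^ (blkOf i.D.toDomains z).1.1 : ℕ) : ℝ)) ^ 2)⁻¹)
    (hb2 : ∀ μ z, ω (shiftY i μ z) / ω z + ω z / ω (shiftY i μ z) - 2 ≤ θb * (((((ℓ + 1) ^ (blkOf i.D.toDomains (shiftY i μ z)).1.1 : ℕ) : ℝ)) ^ 2)⁻¹)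
    (hs : ∀ z w : SiteY i, blkOf i.D.toDomains w = blkOf i.D.toDomains z → ω z / ω w + ω w / ω z - 2 ≤ θs)
    (hκ : ((d : ℝ) + 1) * θb + θs / 2 ≤ κ₀ / 2) (μ : Fin (d + 1))
    {A B : Finset (SiteY i)} {Λ : SiteY i → Matrix (Fin N) (Fin N) ℂ} (hv : ∀ z, z ∉ B → cdsS i U μ Λ z = 0) (hωB : ∀ z ∈ B, ω z = 1)
    {W : ℝ} (hW0 : 0 < W) (hW : ∀ z ∈ A, W ≤ ω z) :
    ∑ z ∈ A, ∑ ν : Fin (d + 1), ∑ a, ∑ b, ‖cdS i U ν (GpY i par U (cdsS i U μ Λ)) z a b‖ ^ 2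
      ≤ 10 * trIP (fun _ => (1 : ℝ)) Λ Λ / W ^ 2 := by
  have hd0 : (0 : ℝ) ≤ d := Nat.cast_nonneg d
  have hθ : ((d : ℝ) + 1) * θb ≤ κ₀ / 2 := by linarith
  have hθb1 : θb ≤ 1 / 16 := by nlinarith
  have hunit : IsUnit (deltaPrimeAY i par U) := isUnit_deltaPrimeAY_of_coer i par hκ₀ hcoer
  set v := cdsS i U μ Λ with hvdef
  have hM0 : 0 ≤ ∑ z : SiteY i, (((((ℓ + 1) ^ (blkOf i.D.toDomains z).1.1 : ℕ) : ℝ)) ^ 2)⁻¹ * ∑ a, ∑ b, ‖(((ω z : ℝ) : ℂ) • GpY i par U v z) a b‖ ^ 2 :=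
    Finset.sum_nonneg fun z _ => mul_nonneg (inv_nonneg.2 (by positivity)) (hs_nonneg _)
  -- Agmon's first reading with the source `v`: `(κ₀ − κ) M ≤ X = ⟨Φ, v⟩`
  have hiX := levelMass_wsmul_GpY_le_pairing_par i par hG hU hpar hinv hκ₀ hcoer hω hb1 hb2 hs hv hωB
  -- `X ≤ ‖λ‖²`
  have hQ0 : 0 ≤ trIP (fun _ => (1 : ℝ)) Λ Λ := trIP_self_nonneg _ (fun _ => one_pos) Λ
  have hΔΦ : deltaPrimeAY i par U (GpY i par U v) = v := apply_inverse_of_isUnit hunit _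
  have hXeq : trIP (fun _ => (1 : ℝ)) (GpY i par U v) v = trIP (fun _ => (1 : ℝ)) (cdS i U μ (GpY i par U v)) Λ := by
    rw [hvdef, trIP_cdS_left i (fun μ x => hG (hU μ x)) μ]
  have hE0 : ∑ ν : Fin (d + 1), trIP (fun _ => (1 : ℝ)) (cdS i U ν (GpY i par U v)) (cdS i U ν (GpY i par U v))
      ≤ trIP (fun _ => (1 : ℝ)) (GpY i par U v) v := by
    have h := sum_trIP_cdS_le_trIP_deltaPrimeAY i hG par U hinv hpar hU (GpY i par U v)
    rwa [hΔΦ] at h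
  have hXQ : trIP (fun _ => (1 : ℝ)) (GpY i par U v) v ≤ trIP (fun _ => (1 : ℝ)) Λ Λ := by
    set X := trIP (fun _ => (1 : ℝ)) (GpY i par U v) v with hX
    have hX0 : 0 ≤ X := le_trans (Finset.sum_nonneg fun _ _ => trIP_self_nonneg _ (fun _ => one_pos) _) hE0
    have hcs := trIP_sq_le (fun _ => (1 : ℝ)) (fun _ => one_pos) (cdS i U μ (GpY i par U v)) Λ
    have hμ : trIP (fun _ => (1 : ℝ)) (cdS i U μ (GpY i par U v)) (cdS i U μ (GpY i par U v)) ≤ X :=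
      le_trans (Finset.single_le_sum (f := fun ν => trIP (fun _ => (1 : ℝ)) (cdS i U ν (GpY i par U v)) (cdS i U ν (GpY i par U v)))
        (fun _ _ => trIP_self_nonneg _ (fun _ => one_pos) _) (Finset.mem_univ μ)) hE0
    have h3 : X ^ 2 ≤ X * trIP (fun _ => (1 : ℝ)) Λ Λ := by
      rw [hXeq]; rw [hXeq] at hμ
      exact hcs.trans (mul_le_mul_of_nonneg_right hμ hQ0)
    rcases hX0.eq_or_lt with h0 | hpos
    · rw [← h0]; exact hQ0
    · have h4 : X * X ≤ trIP (fun _ => (1 : ℝ)) Λ Λ * X := by nlinarith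
      exact le_of_mul_le_mul_right h4 hpos
  -- the energy of the weighted field
  have hE : ∑ ν : Fin (d + 1), trIP (fun _ => (1 : ℝ)) (cdS i U ν (fun w => ((ω w : ℝ) : ℂ) • GpY i par U v w))
        (cdS i U ν (fun w => ((ω w : ℝ) : ℂ) • GpY i par U v w))
      ≤ trIP (fun _ => (1 : ℝ)) (GpY i par U v) v + (((d : ℝ) + 1) * θb + θs / 2) *
          ∑ z : SiteY i, (((((ℓ + 1) ^ (blkOf i.D.toDomains z).1.1 : ℕ) : ℝ)) ^ 2)⁻¹ * ∑ a, ∑ b, ‖(((ω z : ℝ) : ℂ) • GpY i par U v z) a b‖ ^ 2 := by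
    have h1 := sum_trIP_cdS_le_trIP_deltaPrimeAY i hG par U hinv hpar hU (fun w => ((ω w : ℝ) : ℂ) • GpY i par U v w)
    have h2 := trIP_wsmul_deltaPrimeAY_winv_ge i hG par U hinv hpar hU hω hb1 hb2 hs (fun w => ((ω w : ℝ) : ℂ) • GpY i par U v w)
    rw [conj_wsmul_GpY_eq_pairing_par i par hunit hω hv hωB] at h2
    linarith
  have hsum := sum_wsq_hs_cdS_le i hG hU hω hθb0 hθb1 hb2 (GpY i par U v)
  -- restrict to `A`
  have hPA : W ^ 2 * ∑ z ∈ A, ∑ ν : Fin (d + 1), ∑ a, ∑ b, ‖cdS i U ν (GpY i par U v) z a b‖ ^ 2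
      ≤ ∑ z : SiteY i, ∑ ν : Fin (d + 1), ω z ^ 2 * ∑ a, ∑ b, ‖cdS i U ν (GpY i par U v) z a b‖ ^ 2 := by
    rw [Finset.mul_sum]
    have hterm : ∀ z, 0 ≤ ∑ ν : Fin (d + 1), ω z ^ 2 * ∑ a, ∑ b, ‖cdS i U ν (GpY i par U v) z a b‖ ^ 2 :=
      fun z => Finset.sum_nonneg fun _ _ => mul_nonneg (sq_nonneg _) (hs_nonneg _)
    refine le_trans (Finset.sum_le_sum fun z hz => ?_) (Finset.sum_le_univ_sum_of_nonneg hterm)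
    rw [Finset.mul_sum]
    exact Finset.sum_le_sum fun _ _ => mul_le_mul_of_nonneg_right (pow_le_pow_left₀ hW0.le (hW z hz) 2) (hs_nonneg _)
  exact graddiv_arith_par hE hsum hPA hκ hθ hiX hXQ hM0 hW0

/-- ★★ **(3.46e) AT A GENERIC TRANSPORTER WITH THE AGMON WEIGHT `e^{δρ}` AT A PARAMETRIC RATE** (`ρ` bond-Lipschitz at scale `(L^{lev})⁻¹`, block oscillation `≤ d+1`, `ρ = 0` on
`B ⊇ supp ∇\*_{U,μ}λ`, `ρ ≥ r` on `A`; `0 ≤ δ ≤ 1`, `δ(d+1) ≤ 1`, `δ²(2(d+1) + (d+1)²) ≤ κ₀∕2`): `Σ_{z∈A}Σ_ν HS((∇_{U,ν}G′(U; par)∇\*_{U,μ}λ)(z)) ≤ 10·‖λ‖²₁∕(e^{δr})²`.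
[cite: Balaban1985BackgroundPropagators, Thm 3.1 (3.46) p.398; Agmon1982, Ch.1, Thm 1.5] -/
theorem hs_restrict_cdS_GpY_cdsS_le_exp_par [Nonempty (Fin N)] (hG : G ≤ B7Prop2Explicit.unitaryUnits (Matrix (Fin N) (Fin N) ℂ))
    {U : CfgY (Matrix (Fin N) (Fin N) ℂ) i} (hU : ∀ μ x, U μ x ∈ G) (hpar : ∀ z w : SiteY i, par U z w ∈ G)
    (hinv : ∀ z z' : SiteY i, par U z z' = (par U z' z)⁻¹) {κ₀ : ℝ} (hκ₀ : 0 < κ₀) (hκ₀1 : κ₀ ≤ 1 / 8)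
    (hcoer : ∀ Φ : SiteY i → Matrix (Fin N) (Fin N) ℂ,
      κ₀ * ∑ z : SiteY i, (((((ℓ + 1) ^ (blkOf i.D.toDomains z).1.1 : ℕ) : ℝ)) ^ 2)⁻¹ * ∑ a, ∑ b, ‖Φ z a b‖ ^ 2 ≤ trIP (fun _ => (1 : ℝ)) Φ (deltaPrimeAY i par U Φ))
    {δ : ℝ} (hδ0 : 0 ≤ δ) (hδ1 : δ ≤ 1) (hδD : δ * ((d : ℝ) + 1) ≤ 1) (hδκ : δ ^ 2 * (2 * ((d : ℝ) + 1) + ((d : ℝ) + 1) ^ 2) ≤ κ₀ / 2)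
    {ρ : SiteY i → ℝ}
    (hρ1 : ∀ μ z, |ρ (shiftY i μ z) - ρ z| ≤ ((((ℓ + 1) ^ (blkOf i.D.toDomains z).1.1 : ℕ) : ℝ))⁻¹)
    (hρ2 : ∀ μ z, |ρ (shiftY i μ z) - ρ z| ≤ ((((ℓ + 1) ^ (blkOf i.D.toDomains (shiftY i μ z)).1.1 : ℕ) : ℝ))⁻¹)
    (hρD : ∀ z w : SiteY i, blkOf i.D.toDomains w = blkOf i.D.toDomains z → |ρ z - ρ w| ≤ (d : ℝ) + 1) (μ : Fin (d + 1))
    {A B : Finset (SiteY i)} {Λ : SiteY i → Matrix (Fin N) (Fin N) ℂ} (hv : ∀ z, z ∉ B → cdsS i U μ Λ z = 0) (hρB : ∀ z ∈ B, ρ z = 0)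
    {r : ℝ} (hr : ∀ z ∈ A, r ≤ ρ z) :
    ∑ z ∈ A, ∑ ν : Fin (d + 1), ∑ a, ∑ b, ‖cdS i U ν (GpY i par U (cdsS i U μ Λ)) z a b‖ ^ 2
      ≤ 10 * trIP (fun _ => (1 : ℝ)) Λ Λ / Real.exp (δ * r) ^ 2 := by
  have hδκ' : ((d : ℝ) + 1) * (2 * δ ^ 2) + (2 * δ ^ 2 * ((d : ℝ) + 1) ^ 2) / 2 ≤ κ₀ / 2 := by nlinarith
  have hω : ∀ z, 0 < Real.exp (δ * ρ z) := fun z => Real.exp_pos _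
  have hωB : ∀ z ∈ B, Real.exp (δ * ρ z) = 1 := fun z hz => by rw [hρB z hz, mul_zero, Real.exp_zero]
  have hW : ∀ z ∈ A, Real.exp (δ * r) ≤ Real.exp (δ * ρ z) := fun z hz => Real.exp_le_exp.2 (mul_le_mul_of_nonneg_left (hr z hz) hδ0)
  exact hs_restrict_cdS_GpY_cdsS_le_par i par hG hU hpar hinv hκ₀ hκ₀1 hcoer hω (by positivity) (by positivity)
    (fun μ z => bondRatio_exp_le i hδ0 hδ1 μ z (hρ1 μ z)) (fun μ z => bondRatio_exp_le' i hδ0 hδ1 μ z (hρ2 μ z))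
    (fun z w hzw => blockOsc_exp_le i hδ0 hδD z w (hρD z w hzw)) hδκ' μ hv hωB (Real.exp_pos _) hW

end Literature.MathematicalPhysics.QuantumFieldTheory.Balaban1983to89.B9Thm31SiteGradGpDivDecayPar

end
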